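import Summits.ValiantsHypothesis.ValiantsHypothesis.Theorems.LacunarySymmetroidMatrixDescartesWLawNotSharp
import Summits.ValiantsHypothesis.ValiantsHypothesis.Theorems.LacunarySymmetroidMatrixDescartesPivotIndexGraded
import Summits.ValiantsHypothesis.ValiantsHypothesis.Theorems.LacunarySymmetroidMatrixDescartesCensusPivotBridge

/-!
# `MatrixDescartes` (stmt-ValiantsHypothesis-18050) — W CHAMBER ROWS: `Z₊ ≤ C(n+3, n) − r` whenever `(r−1)·(d₁ − d₂) < e − d₂`

HONEST FRAMING.  Cell `pub-symmetroid`, seat `val-sym-mdr-p2` (gen 26); helper file `--supports` the crux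
`Theses.LacunarySymmetroid.MatrixDescartes` (OPEN), NO closure claim.  Refines `…WLawNotSharp` (`r = 2`, every W-row) chamber by chamber:
in a W-pencil `X^e J + X^{d₁} P₁ + X^{d₂} P₂ + X^{d₃} Q` (`d₂ < d₁ < e < d₃`, `P₁, P₂, Q ⪰ 0`, `J` arbitrary) the `r` smallest count-vector
exponents are `(n−k)·d₂ + k·d₁` (`k < r`) as long as `(r−1)(d₁ − d₂) < e − d₂`; none of them is reachable through the pivot letter, so their
coefficients are those of the PSD pencil `X^{d₁} P₁ + X^{d₂} P₂ + X^{d₃} Q` — sums of squares in the signed Gram expansion — and a bottom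
run of `r` non-negative coefficients costs `r − 1` of Descartes' sign changes.
* `coeff_det_psd_pencil_nonneg` (PSD letters ⇒ every coefficient `≥ 0`, any size, any `K`); `coeff_pivot_eq_coeff_letters_of_lt` (below
  the pivot level `e + m·min d` a pivot pencil of size `m + 1` has the coefficients of its letter part);
* `signVariations_le_card_support_of_top_run_nonneg` / `…_of_bot_run_nonneg` (a run of non-negative coefficients above / below the
  rest of the support costs nothing: `V ≤ #supp(rest)`);
* **`wLaw_chamber`**: `1 ≤ r ≤ n + 1`, `(r−1)·(d₁−d₂) < e−d₂` ⇒ `Z₊ ≤ C(n+3, n) − r`; **`wLaw_adjacent_lower_letters`**: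
  `n·(d₁ − d₂) < e − d₂ ⇒ Z₊ ≤ C(n+3, n) − (n + 1)`.
The `4n − 2` witnesses of the column have `P₁` adjacent to the pivot (`r = 2`), so these rows do not move `w(n)`; nothing here bears on
`MatrixDescartes` in its window, on `stub_twoSided`, on `DoorA26` / `DoorA34`, on the cell's registers, or on `VP ≠ VNP`.

[folklore] Leibniz expansion (`TrailingCoeffs.coeff_det_pencil_eq`), signed Gram expansion (`Pivot.IndexGraded.pencil_eq_gram`,
`Pivot.GramExpansion.coeff_det_gramPencil`), Descartes' rule of signs, reflection.  No definitions, no named facts.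
-/

-- `Summit.ValiantsHypothesis.ValiantsHypothesis.…` repeats a component by the single-conjunct
-- summit layout, which the `dupNamespace` linter flags; the name is mandated.
set_option linter.dupNamespace false

namespace Summit.ValiantsHypothesis.ValiantsHypothesis.Theorems.LacunarySymmetroidMatrixDescartes

open Polynomial Finset Matrix TrailingCoeffs WLawNotSharp
open scoped BigOperators Polynomial Matrix MatrixOrder

namespace WLawChambers

variable {K m : ℕ}

/-! ### 1. PSD pencils have non-negative coefficients; the pivot does not reach low exponents -/

/-- Every coefficient of `det (∑ₖ X^{dₖ} • Pₖ)` with all `Pₖ ⪰ 0` is non-negative (signed Gram expansion with no negative column).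
[folklore] -/
theorem coeff_det_psd_pencil_nonneg (d : Fin K → ℕ) (P : Fin K → Matrix (Fin m) (Fin m) ℝ) (hP : ∀ k, (P k).PosSemidef) (n : ℕ) :
    0 ≤ (Matrix.det (∑ k, ((X : ℝ[X]) ^ d k) • (P k).map C)).coeff n := by
  classical
  choose S hS using fun k => Pivot.ResolventDescartes.exists_eq_mul_transpose (P k) (hP k)
  have hS₀ : (0 : Matrix (Fin m) (Fin m) ℝ) + (0 : Matrix (Fin m) (Fin 0) ℝ) * (0 : Matrix (Fin m) (Fin 0) ℝ)ᵀ
      = (0 : Matrix (Fin m) (Fin m) ℝ) * (0 : Matrix (Fin m) (Fin m) ℝ)ᵀ := by simp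
  set ε := Fintype.equivFin ((Option (Fin K) × Fin m) ⊕ Fin 0)
  have h := Pivot.IndexGraded.pencil_eq_gram 0 d 0 P (0 : Matrix (Fin m) (Fin 0) ℝ) 0 S hS₀ hS ε
  rw [Matrix.map_zero _ (map_zero C), smul_zero, zero_add] at h
  rw [h, Pivot.GramExpansion.coeff_det_gramPencil]
  refine Finset.sum_nonneg fun t _ => ?_
  split_ifs
  · refine mul_nonneg (Finset.prod_nonneg fun a _ => ?_) (sq_nonneg _)
    rcases ε.symm (t a) with oc | c
    · simp
    · exact Fin.elim0 c
  · exact le_rfl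

/-- **Below the pivot level the pivot letter does not contribute**: for a pivot pencil of size `m + 1` whose letter exponents and pivot
exponent are all `≥ d k₀`, and an exponent `E < e + m · d k₀`, the coefficient of `X^E` is the coefficient of the letter part
`∑ₖ X^{dₖ} • Pₖ` (a row-to-letter map through the pivot has exponent `≥ e + m·d k₀`). [folklore] -/
theorem coeff_pivot_eq_coeff_letters_of_lt (e : ℕ) (d : Fin K → ℕ) (J : Matrix (Fin (m + 1)) (Fin (m + 1)) ℝ)
    (P : Fin K → Matrix (Fin (m + 1)) (Fin (m + 1)) ℝ) {k₀ : Fin K} (hmin : ∀ k, d k₀ ≤ d k) (he : d k₀ ≤ e) {E : ℕ}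
    (hE : E < e + m * d k₀) :
    (Matrix.det (((X : ℝ[X]) ^ e) • J.map C + ∑ k, ((X : ℝ[X]) ^ d k) • (P k).map C)).coeff E
      = (Matrix.det (∑ k, ((X : ℝ[X]) ^ d k) • (P k).map C)).coeff E := by
  classical
  rw [Pivot.pivot_pencil_eq_cons, coeff_det_pencil_eq, coeff_det_pencil_eq]
  refine Finset.sum_congr rfl fun σ _ => ?_
  set d' : Fin (K + 1) → ℕ := Fin.cons e d with hd'
  set S' : Fin (K + 1) → Matrix (Fin (m + 1)) (Fin (m + 1)) ℝ := Fin.cons J P with hS'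
  have hge : ∀ l, d k₀ ≤ d' l := fun l => Fin.cases (by simpa [hd'] using he) (fun k => by simpa [hd'] using hmin k) l
  set emb : (Fin (m + 1) → Fin K) → (Fin (m + 1) → Fin (K + 1)) := fun g i => (g i).succ with hemb
  have hemb_inj : ∀ g₁ ∈ (Finset.univ : Finset (Fin (m + 1) → Fin K)), ∀ g₂ ∈ (Finset.univ : Finset (Fin (m + 1) → Fin K)),
      emb g₁ = emb g₂ → g₁ = g₂ := by
    intro g₁ _ g₂ _ h
    funext i
    have := congrFun h i
    simp only [hemb] at this
    exact Fin.succ_injective _ this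
  have hzero : ∀ f : Fin (m + 1) → Fin (K + 1), f ∉ Finset.univ.image emb →
      (if E = ∑ i, d' (f i) then ((Equiv.Perm.sign σ : ℤ) : ℝ) * ∏ i, S' (f i) (σ i) i else 0) = 0 := by
    intro f hf
    obtain ⟨i₀, hi₀⟩ : ∃ i, f i = 0 := by
      by_contra h
      push Not at h
      refine hf (Finset.mem_image.mpr ⟨fun i => (f i).pred (h i), Finset.mem_univ _, funext fun i => ?_⟩)
      simp [hemb]
    rw [if_neg]
    apply ne_of_lt
    calc E < e + m * d k₀ := hE
      _ = d' (f i₀) + ∑ _i ∈ Finset.univ.erase i₀, d k₀ := by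
          rw [hi₀, Finset.sum_const, Finset.card_erase_of_mem (Finset.mem_univ _), Finset.card_univ, Fintype.card_fin,
            smul_eq_mul, Nat.add_sub_cancel, hd', Fin.cons_zero]
      _ ≤ d' (f i₀) + ∑ i ∈ Finset.univ.erase i₀, d' (f i) :=
          Nat.add_le_add_left (Finset.sum_le_sum fun i _ => hge (f i)) _
      _ = ∑ i, d' (f i) := Finset.add_sum_erase Finset.univ (fun i => d' (f i)) (Finset.mem_univ i₀)
  rw [← Finset.sum_subset (Finset.subset_univ (Finset.univ.image emb)) (fun f _ hf => hzero f hf), Finset.sum_image hemb_inj]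
  refine Finset.sum_congr rfl fun g _ => ?_
  simp [hd', hS', hemb]

/-! ### 2. Runs of non-negative coefficients at an end cost nothing -/

/-- TOP RUN: if the coefficients of `f` at all degrees `≥ D` are `≥ 0`, then `V(f) ≤ #supp (part of f below D)`. Formulated as:
`f = g + R` with `deg R < D`, every coefficient of `g` non-negative and supported in degrees `≥ D` ⇒ `V(f) ≤ #supp R`. [folklore] -/
theorem signVariations_le_card_support_of_top_run_nonneg :
    ∀ (c : ℕ) (g R : ℝ[X]) (D : ℕ), g.support.card = c → (∀ i, 0 ≤ g.coeff i) → (∀ i ∈ g.support, D ≤ i) →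
      R.degree < ((D : ℕ) : WithBot ℕ) → (g + R).signVariations ≤ R.support.card := by
  intro c
  induction c with
  | zero =>
    intro g R D hc _ _ _
    rw [Finset.card_eq_zero, Polynomial.support_eq_empty] at hc
    rw [hc, zero_add]
    exact signVariations_le_card_support R
  | succ c ih =>
    intro g R D hc hnn hsupp hR
    have hg0 : g ≠ 0 := fun h => by rw [h, Polynomial.support_zero, Finset.card_empty] at hc; exact Nat.succ_ne_zero c hc.symm
    set a := g.leadingCoeff with ha
    set N := g.natDegree with hN
    have ha0 : 0 < a := lt_of_le_of_ne (hnn N) (fun h => hg0 (leadingCoeff_eq_zero.mp h.symm))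
    have hsplit : g + R = C a * X ^ N + (g.eraseLead + R) := by
      have h := g.eraseLead_add_C_mul_X_pow
      rw [← ha, ← hN] at h
      conv_lhs => rw [← h]
      ring
    have hNmem : N ∈ g.support := natDegree_mem_support_of_nonzero hg0
    have hDN : D ≤ N := hsupp N hNmem
    have hc' : g.eraseLead.support.card = c := by
      have := card_support_eraseLead_add_one hg0; omega
    have hnn' : ∀ i, 0 ≤ g.eraseLead.coeff i := fun i => by
      by_cases hi : i = N
      · rw [hi, hN, eraseLead_coeff_natDegree]
      · rw [eraseLead_coeff_of_ne _ (hN ▸ hi)]; exact hnn i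
    have hsupp' : ∀ i ∈ g.eraseLead.support, D ≤ i := fun i hi => by
      rw [eraseLead_support] at hi; exact hsupp i (Finset.mem_erase.mp hi).2
    have hrec := ih g.eraseLead R D hc' hnn' hsupp' hR
    have htail : (g.eraseLead + R).degree < ((N : ℕ) : WithBot ℕ) := by
      refine (degree_add_le _ _).trans_lt (max_lt ?_ (hR.trans_le (by exact_mod_cast hDN)))
      by_cases he0 : g.eraseLead = 0
      · rw [he0, degree_zero]; exact WithBot.bot_lt_coe _
      · have h1 := eraseLead_natDegree_lt_or_eraseLead_eq_zero g
        rcases h1 with h1 | h1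
        · rw [degree_eq_natDegree he0]; exact_mod_cast h1
        · exact absurd h1 he0
    rw [hsplit, Literature.Algebra.Polynomial.signVariations_C_mul_X_pow_add ha0.ne' htail]
    by_cases he0 : g.eraseLead = 0
    · rw [he0, zero_add] at hrec ⊢
      by_cases hR0 : R = 0
      · subst hR0; simp [sign_pos ha0]
      · calc R.signVariations + (if SignType.sign a = -SignType.sign R.leadingCoeff then 1 else 0)
            ≤ R.signVariations + 1 := by gcongr; split_ifs <;> simp
          _ ≤ R.support.card := signVariations_add_one_le_card_support hR0
    · have hlead : (g.eraseLead + R).leadingCoeff = g.eraseLead.leadingCoeff := by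
        rw [leadingCoeff_add_of_degree_lt']
        refine hR.trans_le ?_
        rw [degree_eq_natDegree he0]
        exact_mod_cast hsupp' _ (natDegree_mem_support_of_nonzero he0)
      have hpos : 0 < g.eraseLead.leadingCoeff :=
        lt_of_le_of_ne (hnn' _) (fun h => he0 (leadingCoeff_eq_zero.mp h.symm))
      rw [hlead, if_neg, add_zero]
      · exact hrec
      · rw [sign_pos ha0, sign_pos hpos]; decide

/-- BOTTOM RUN (by reflection): `g` with non-negative coefficients supported in degrees `< D`, every exponent of `R` at least `D`
⇒ `V(g + R) ≤ #supp R`. [folklore] -/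
theorem signVariations_le_card_support_of_bot_run_nonneg (g R : ℝ[X]) (D : ℕ) (hnn : ∀ i, 0 ≤ g.coeff i)
    (hsupp : ∀ i ∈ g.support, i < D) (hR : ∀ i ∈ R.support, D ≤ i) : (g + R).signVariations ≤ R.support.card := by
  classical
  set N := max D R.natDegree with hN
  have hDN : D ≤ N := le_max_left _ _
  have hRN : R.natDegree ≤ N := le_max_right _ _
  have hgN : g.natDegree ≤ N := by
    by_cases hg : g = 0
    · rw [hg, natDegree_zero]; exact Nat.zero_le _
    · exact (hsupp _ (natDegree_mem_support_of_nonzero hg)).le.trans hDN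
  have hdeg : (g + R).natDegree ≤ N := (natDegree_add_le _ _).trans (max_le hgN hRN)
  rw [← Literature.Algebra.Polynomial.signVariations_reflect _ hdeg, reflect_add]
  have hsuppR : (reflect N R).support.card = R.support.card := by
    rw [reflect_support, Finset.card_image_of_injective _ (revAt N).injective]
  rw [← hsuppR]
  refine signVariations_le_card_support_of_top_run_nonneg _ (reflect N g) (reflect N R) (N - D + 1) rfl (fun i => ?_)
    (fun i hi => ?_) ?_
  · rw [coeff_reflect]; exact hnn _
  · rw [reflect_support, Finset.mem_image] at hi
    obtain ⟨j, hj, rfl⟩ := hi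
    have hjD := hsupp j hj
    rw [revAt_le (hjD.le.trans hDN)]; omega
  · rw [degree_lt_iff_coeff_zero]
    intro i hi
    rw [coeff_reflect]
    by_contra hne
    have hmem : revAt N i ∈ R.support := mem_support_iff.mpr hne
    have h1 := hR _ hmem
    have h2 : revAt N i ≤ R.natDegree := le_natDegree_of_mem_supp _ hmem
    have hiN : i ≤ N := by
      by_contra hcon
      push Not at hcon
      rw [revAt_eq_self_of_lt hcon] at h2; omega
    rw [revAt_le hiN] at h1
    have : (N - D + 1 : ℕ) ≤ i := by exact_mod_cast hi
    omega

/-! ### 3. The chamber rows -/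

/-- **W CHAMBER ROWS.**  `d₂ < d₁ < e < d₃`, `P₁, P₂, Q ⪰ 0`, `J` arbitrary; if `1 ≤ r ≤ n + 1` and `(r−1)·(d₁ − d₂) < e − d₂` then
`Z₊ ≤ C(n+3, n) − r`: the `r` exponents `(n−k)·d₂ + k·d₁` (`k < r`) lie below the pivot level `e + (n−1)·d₂`, their coefficients are
coefficients of the PSD pencil `X^{d₁}P₁ + X^{d₂}P₂ + X^{d₃}Q` (`≥ 0`), and every other count-vector exponent is larger. [folklore] -/
theorem wLaw_chamber {n : ℕ} (hn : 1 ≤ n) (e d₁ d₂ d₃ : ℕ) (J P₁ P₂ Q : Matrix (Fin n) (Fin n) ℝ)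
    (hP₁ : P₁.PosSemidef) (hP₂ : P₂.PosSemidef) (hQ : Q.PosSemidef) (h21 : d₂ < d₁) (h1e : d₁ < e) (he3 : e < d₃)
    {r : ℕ} (hr1 : 1 ≤ r) (hrn : r ≤ n + 1) (hcham : (r - 1) * (d₁ - d₂) < e - d₂) :
    ((Matrix.det (((X : ℝ[X]) ^ e) • J.map C + ((X : ℝ[X]) ^ d₁) • P₁.map C
        + ((X : ℝ[X]) ^ d₂) • P₂.map C + ((X : ℝ[X]) ^ d₃) • Q.map C)).roots.toFinset.filter (fun t => 0 < t)).card
      ≤ Nat.choose (n + 3) n - r := by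
  classical
  obtain ⟨m, rfl⟩ : ∃ m, n = m + 1 := ⟨n - 1, by omega⟩
  set dL : Fin 3 → ℕ := ![d₁, d₂, d₃] with hdL
  set PL : Fin 3 → Matrix (Fin (m + 1)) (Fin (m + 1)) ℝ := ![P₁, P₂, Q] with hPL
  have hPLpsd : ∀ k, (PL k).PosSemidef := by intro k; fin_cases k <;> assumption
  have hpiv : ((X : ℝ[X]) ^ e) • J.map C + ((X : ℝ[X]) ^ d₁) • P₁.map C + ((X : ℝ[X]) ^ d₂) • P₂.map C
        + ((X : ℝ[X]) ^ d₃) • Q.map C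
      = ((X : ℝ[X]) ^ e) • J.map C + ∑ k, ((X : ℝ[X]) ^ dL k) • (PL k).map C := by
    rw [Fin.sum_univ_three]; simp only [hdL, hPL, Matrix.cons_val_zero, Matrix.cons_val_one, Matrix.cons_val_two,
      Matrix.head_cons, Matrix.tail_cons]; abel
  rw [hpiv]
  set F := Matrix.det (((X : ℝ[X]) ^ e) • J.map C + ∑ k, ((X : ℝ[X]) ^ dL k) • (PL k).map C) with hF
  set F₀ := Matrix.det (∑ k, ((X : ℝ[X]) ^ dL k) • (PL k).map C) with hF₀
  set g₁ := d₁ - d₂ with hg₁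
  have hd₁ : d₁ = d₂ + g₁ := by omega
  set Er : ℕ → ℕ := fun k => (m + 1) * d₂ + k * g₁ with hEr
  have hEr_lt : ∀ {a b : ℕ}, a < b → Er a < Er b := fun {a b} hab => by
    simp only [hEr]; have : 0 < g₁ := by omega
    nlinarith
  have hEr_inj : ∀ {a b : ℕ}, Er a = Er b → a = b := fun {a b} h => by
    rcases lt_trichotomy a b with hab | hab | hab
    · exact absurd h (hEr_lt hab).ne
    · exact hab
    · exact absurd h (hEr_lt hab).ne'
  have hlevel : ∀ k, k < r → Er k < e + m * d₂ := by
    intro k hk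
    simp only [hEr]
    have h1 : k * g₁ ≤ (r - 1) * g₁ := Nat.mul_le_mul_right _ (by omega)
    have h2 : (m + 1) * d₂ = m * d₂ + d₂ := by ring
    omega
  have hexp : ∀ f : Fin (m + 1) → Fin (3 + 1),
      (∑ i, (Fin.cons e dL : Fin (3 + 1) → ℕ) (f i)) = e + m * d₂ ∨ e + m * d₂ < (∑ i, (Fin.cons e dL : Fin (3 + 1) → ℕ) (f i)) ∨
        ∃ k, k ≤ m + 1 ∧ (∑ i, (Fin.cons e dL : Fin (3 + 1) → ℕ) (f i)) = Er k := by
    intro f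
    set d' : Fin (3 + 1) → ℕ := Fin.cons e dL with hd'
    have hd'v : ∀ l : Fin (3 + 1), d' l = (![e, d₁, d₂, d₃] : Fin 4 → ℕ) l := by
      intro l; fin_cases l <;> simp [hd', hdL]
    have hge : ∀ l, d₂ ≤ d' l := by intro l; rw [hd'v]; fin_cases l <;> simp <;> omega
    by_cases hbig : ∃ i, f i = 0 ∨ f i = 3
    · -- a row in the pivot or in `Q`: exponent ≥ e + m·d₂
      obtain ⟨i₀, hi₀⟩ := hbig
      have hi₀' : e ≤ d' (f i₀) := by
        rcases hi₀ with h | h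
        · rw [h, hd'v]; simp
        · rw [h, hd'v]; simp; omega
      have hsum : e + m * d₂ ≤ ∑ i, d' (f i) := by
        calc e + m * d₂ = e + ∑ _i ∈ Finset.univ.erase i₀, d₂ := by
              rw [Finset.sum_const, Finset.card_erase_of_mem (Finset.mem_univ _), Finset.card_univ, Fintype.card_fin,
                smul_eq_mul, Nat.add_sub_cancel]
          _ ≤ d' (f i₀) + ∑ i ∈ Finset.univ.erase i₀, d' (f i) := Nat.add_le_add hi₀' (Finset.sum_le_sum fun i _ => hge (f i))
          _ = ∑ i, d' (f i) := Finset.add_sum_erase Finset.univ (fun i => d' (f i)) (Finset.mem_univ i₀)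
      rcases hsum.eq_or_lt with h | h
      · exact Or.inl h.symm
      · exact Or.inr (Or.inl h)
    · -- all rows in `P₁` (index 1) or `P₂` (index 2)
      push Not at hbig
      right; right
      set A := Finset.univ.filter (fun i => f i = 1) with hA
      refine ⟨A.card, (Finset.card_le_univ A).trans (by rw [Fintype.card_fin]), ?_⟩
      have hval : ∀ i, d' (f i) = d₂ + (if f i = 1 then g₁ else 0) := by
        intro i
        have h12 : f i = 1 ∨ f i = 2 := by
          rcases hbig i with ⟨h0, h3⟩
          have : (f i).val < 4 := (f i).isLt
          have hv : (f i).val ≠ 0 := fun h => h0 (Fin.ext h)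
          have hv3 : (f i).val ≠ 3 := fun h => h3 (Fin.ext h)
          rcases Nat.lt_or_ge (f i).val 2 with h | h
          · left; exact Fin.ext (by simp; omega)
          · right; exact Fin.ext (by simp; omega)
        rcases h12 with h | h
        · rw [h, if_pos rfl, hd'v]; simp [hd₁]
        · rw [h, if_neg (by decide), hd'v]; simp
      simp only [hEr]
      rw [Finset.sum_congr rfl fun i _ => hval i, Finset.sum_add_distrib, Finset.sum_const, Finset.card_univ, Fintype.card_fin,
        smul_eq_mul, ← Finset.sum_filter, Finset.sum_const, smul_eq_mul, hA]
  have hnn : ∀ k, k < r → 0 ≤ F.coeff (Er k) := by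
    intro k hk
    rw [hF, coeff_pivot_eq_coeff_letters_of_lt e dL J PL (k₀ := (1 : Fin 3)) (fun l => by fin_cases l <;> simp [hdL] <;> omega)
      (by simp [hdL]; omega) (by simpa [hdL] using hlevel k hk)]
    exact coeff_det_psd_pencil_nonneg dL PL hPLpsd _
  set gpoly : ℝ[X] := ∑ k ∈ Finset.range r, C (F.coeff (Er k)) * X ^ Er k with hg
  set R := F - gpoly with hR
  have hgcoeff : ∀ i, gpoly.coeff i = ∑ k ∈ Finset.range r, if i = Er k then F.coeff (Er k) else 0 := by
    intro i; rw [hg, finsetSum_coeff]; simp only [coeff_C_mul_X_pow]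
  have hgcoeff_run : ∀ k, k < r → gpoly.coeff (Er k) = F.coeff (Er k) := by
    intro k hk
    rw [hgcoeff, Finset.sum_eq_single k]
    · rw [if_pos rfl]
    · intro k' _ hk'; rw [if_neg (fun h => hk' (hEr_inj h).symm)]
    · intro hk'; exact absurd (Finset.mem_range.mpr hk) hk'
  have hgcoeff_off : ∀ i, (∀ k, k < r → i ≠ Er k) → gpoly.coeff i = 0 := by
    intro i hi
    rw [hgcoeff]
    exact Finset.sum_eq_zero fun k hk => if_neg (hi k (Finset.mem_range.mp hk))
  have hgnn : ∀ i, 0 ≤ gpoly.coeff i := by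
    intro i; rw [hgcoeff]
    exact Finset.sum_nonneg fun k hk => by
      split_ifs
      · exact hnn k (Finset.mem_range.mp hk)
      · exact le_rfl
  have hgsupp : ∀ i ∈ gpoly.support, i ≤ Er (r - 1) := by
    intro i hi
    by_contra hcon
    refine (mem_support_iff.mp hi) (hgcoeff_off i fun k hk heq => ?_)
    rw [heq] at hcon
    exact hcon ((Nat.lt_or_eq_of_le (Nat.le_sub_one_of_lt hk)).elim (fun h => (hEr_lt h).le) (fun h => (congrArg Er h).le))
  set I := (Finset.univ : Finset (Sym (Fin (3 + 1)) (m + 1))).image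
      (fun s : Sym (Fin (3 + 1)) (m + 1) => ((s : Multiset (Fin (3 + 1))).map (Fin.cons e dL)).sum) with hI
  have hRsupp : ∀ i ∈ R.support, Er (r - 1) < i ∧ i ∈ I \ (Finset.range r).image Er := by
    intro i hi
    have hRi : R.coeff i ≠ 0 := mem_support_iff.mp hi
    have hRi' : R.coeff i = F.coeff i - gpoly.coeff i := by rw [hR, coeff_sub]
    have hoff : ∀ k, k < r → i ≠ Er k := by
      intro k hk heq
      apply hRi; rw [hRi', heq, hgcoeff_run k hk, sub_self]
    have hFi : F.coeff i ≠ 0 := by rw [hRi', hgcoeff_off i hoff, sub_zero] at hRi; exact hRi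
    have hFi' : (Matrix.det (∑ l, ((X : ℝ[X]) ^ (Fin.cons e dL : Fin (3 + 1) → ℕ) l) •
        ((Fin.cons J PL : Fin (3 + 1) → Matrix (Fin (m + 1)) (Fin (m + 1)) ℝ) l).map C)).coeff i ≠ 0 := by
      rwa [hF, Pivot.pivot_pencil_eq_cons] at hFi
    have hiI : i ∈ I := StubDescartesCeiling.support_det_pencil_subset _ _ (mem_support_iff.mpr hFi')
    obtain ⟨f, hf⟩ : ∃ f : Fin (m + 1) → Fin (3 + 1), (∑ t, (Fin.cons e dL : Fin (3 + 1) → ℕ) (f t)) = i := by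
      by_contra h; push Not at h
      exact hFi' (StubDescartesCeiling.coeff_det_pencil_eq_zero _ _ h)
    have hgt : Er (r - 1) < i := by
      rcases hexp f with h1 | h2 | ⟨k, hk, hk'⟩
      · rw [← hf, h1]; exact hlevel (r - 1) (by omega)
      · rw [← hf]; exact (hlevel (r - 1) (by omega)).trans h2
      · rw [← hf, hk']
        have hkr : r ≤ k := by
          by_contra hlt; push Not at hlt
          exact hoff k hlt (by rw [← hf, hk'])
        exact hEr_lt (by omega)
    refine ⟨hgt, Finset.mem_sdiff.mpr ⟨hiI, fun hmem => ?_⟩⟩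
    obtain ⟨k, hk, hki⟩ := Finset.mem_image.mp hmem
    exact hoff k (Finset.mem_range.mp hk) hki.symm
  have hrunI : (Finset.range r).image Er ⊆ I := by
    intro x hx
    obtain ⟨k, hk, rfl⟩ := Finset.mem_image.mp hx
    have hkm : k ≤ m + 1 := by have := Finset.mem_range.mp hk; omega
    have hcard : Multiset.card (Multiset.replicate k (1 : Fin (3 + 1)) + Multiset.replicate (m + 1 - k) (2 : Fin (3 + 1))) = m + 1 := by
      rw [Multiset.card_add, Multiset.card_replicate, Multiset.card_replicate]; omega
    refine Finset.mem_image.mpr ⟨⟨_, hcard⟩, Finset.mem_univ _, ?_⟩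
    change (Multiset.map (Fin.cons e dL : Fin (3 + 1) → ℕ)
      (Multiset.replicate k (1 : Fin (3 + 1)) + Multiset.replicate (m + 1 - k) (2 : Fin (3 + 1)))).sum = Er k
    rw [Multiset.map_add, Multiset.map_replicate, Multiset.map_replicate, Multiset.sum_add, Multiset.sum_replicate,
      Multiset.sum_replicate, smul_eq_mul, smul_eq_mul]
    have h1 : (Fin.cons e dL : Fin (3 + 1) → ℕ) 1 = d₁ := by simp [hdL]
    have h2 : (Fin.cons e dL : Fin (3 + 1) → ℕ) 2 = d₂ := by simp [hdL]
    rw [h1, h2, hd₁]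
    simp only [hEr]
    have hsplit : (m + 1 - k) + k = m + 1 := by omega
    calc k * (d₂ + g₁) + (m + 1 - k) * d₂ = ((m + 1 - k) + k) * d₂ + k * g₁ := by ring
      _ = (m + 1) * d₂ + k * g₁ := by rw [hsplit]
  have hruncard : ((Finset.range r).image Er).card = r := by
    rw [Finset.card_image_of_injOn (fun a _ b _ h => hEr_inj h), Finset.card_range]
  have hIcard : I.card ≤ Nat.choose (m + 1 + 3) (m + 1) :=
    calc I.card ≤ (Finset.univ : Finset (Sym (Fin (3 + 1)) (m + 1))).card := Finset.card_image_le
      _ = Nat.choose (m + 1 + 3) (m + 1) := by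
          rw [Finset.card_univ, Sym.card_sym_eq_choose, Fintype.card_fin, show 3 + 1 + (m + 1) - 1 = m + 1 + 3 by omega]
  have hRcard : R.support.card ≤ Nat.choose (m + 1 + 3) (m + 1) - r := by
    have h1 : R.support ⊆ I \ (Finset.range r).image Er := fun i hi => (hRsupp i hi).2
    have h2 := Finset.card_le_card h1
    rw [Finset.card_sdiff_of_subset hrunI, hruncard] at h2
    omega
  have hFR : F = gpoly + R := by rw [hR]; ring
  rw [hFR]
  refine (WLawTwoChambers.card_posRoots_le_signVariations _).trans
    ((signVariations_le_card_support_of_bot_run_nonneg gpoly R (Er (r - 1) + 1) hgnn (fun i hi => Nat.lt_succ_of_le (hgsupp i hi))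
      fun i hi => (hRsupp i hi).1).trans hRcard)

/-- **Adjacent lower letters**: `n·(d₁ − d₂) < e − d₂ ⇒ Z₊ ≤ C(n+3, n) − (n + 1)`. [folklore] -/
theorem wLaw_adjacent_lower_letters {n : ℕ} (hn : 1 ≤ n) (e d₁ d₂ d₃ : ℕ) (J P₁ P₂ Q : Matrix (Fin n) (Fin n) ℝ)
    (hP₁ : P₁.PosSemidef) (hP₂ : P₂.PosSemidef) (hQ : Q.PosSemidef) (h21 : d₂ < d₁) (h1e : d₁ < e) (he3 : e < d₃)
    (hcham : n * (d₁ - d₂) < e - d₂) :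
    ((Matrix.det (((X : ℝ[X]) ^ e) • J.map C + ((X : ℝ[X]) ^ d₁) • P₁.map C
        + ((X : ℝ[X]) ^ d₂) • P₂.map C + ((X : ℝ[X]) ^ d₃) • Q.map C)).roots.toFinset.filter (fun t => 0 < t)).card
      ≤ Nat.choose (n + 3) n - (n + 1) :=
  wLaw_chamber hn e d₁ d₂ d₃ J P₁ P₂ Q hP₁ hP₂ hQ h21 h1e he3 (by omega) le_rfl (by simpa using hcham)

end WLawChambers

end Summit.ValiantsHypothesis.ValiantsHypothesis.Theorems.LacunarySymmetroidMatrixDescartes
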